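import Literature.Geometry.Kaehler.EhresmannChartBallTrivialisation
import Literature.Geometry.Kaehler.KaehlerPullback
import Literature.Geometry.Kaehler.TransportDefectContinuity
import Literature.AlgebraicGeometry.Motives.HodgeNumberFibreSemicontinuity
import HarnessLib

/-!
# Transport defects of the chart-ball trivialisation AT THE CENTRE — DEPENDENT fibre diffeomorphisms

Layer `Literature/Geometry/Kaehler`; one theorem, no definition, no named fact.  Prover seat `hodge-nonav-19716-p2` (g11,
cell `hodge-nonav`), companion K0c of prover-Bx's programme «GRIFFITHS-HOLOMORPHY» in the form its consumer (K7) can apply: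
`ChartBallTransportDefectsCentre.eventually_transport_defects_le_centre` takes a TOTAL family `e : ∀ p : EB, X s₀ ≅ X (c⁻¹ p)`,
but clause (4) of `IsProperHolomorphicSubmersion.exists_chartBall_trivialisation` (the only producer) gives `∀ p ∈ ball, ∃ e, …`,
i.e. a DEPENDENT family `e : ∀ p ∈ ball (c s₀) r, X s₀ ≅ X (c⁻¹ p)` (a total one need not exist: the junk fibres `X (c⁻¹ p)`,
`p ∉ ball`, need not be diffeomorphic to `X s₀`).  This file re-proves the theorem VERBATIM with the dependent binders
`(e : ∀ p ∈ ball (c s₀) r, …)`, `(he : ∀ p (hp : p ∈ ball) x, ι (c⁻¹ p) (e p hp x) = Φ p x)`; the conclusion reads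
`∀ᶠ z in 𝓝 (c s₀), ∃ hz : z ∈ ball, …` about `e z hz`.
* **`eventually_transport_defects_le_centre_dep`** — with `Φ (c s₀) = ι s₀` and the fibre metric `g s₀ = (ι s₀)^* G`: for every
  `g s₀`-orthonormal frame field `b` of `X s₀` and `ε > 0`, for all `z` near `c s₀`, `z ∈ D` and `e z hz` has Gram defect
  `|⟪D(e z hz) bᵢ, D(e z hz) bⱼ⟫ − δᵢⱼ| ≤ ε` and holomorphy defect `‖J ∘ D(e z hz) − D(e z hz) ∘ J‖ ≤ ε`.  Proof = the proof of
  `eventually_transport_defects_le_centre` (joint family `F (w, x) = Φ w x`, `F (c s₀, ·) = ι s₀`, `Ψ = e z hz`).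
HONEST FRAMING: an analytic brick; nothing here says HC or any rung is proved.

## References
* [VoisinHodgeI2002] C. Voisin, Hodge Theory and Complex Algebraic Geometry I (2002), §9.1.1 Thm. 9.3, Prop. 9.5; §9.3.2 Prop. 9.20.
* [Kodaira2005] K. Kodaira, Complex Manifolds and Deformation of Complex Structures, §2.3 Thm. 2.5, §7.2.
-/

noncomputable section

open scoped Manifold ContDiff Topology InnerProductSpace
open Bundle Module Set Filter Function Metric
open Literature.Geometry.Manifold Literature.NumberTheory.Transcendental Literature.AlgebraicGeometry.Motives

namespace Literature.Geometry.Kaehler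

-- The identification `TangentSpace I x = E` is an abuse of definitional equality; as in the tree's
-- tangent-bundle files we let `isDefEq` unfold it.
set_option backward.isDefEq.respectTransparency false

universe u

section ChartBall

variable {EX : Type u} [NormedAddCommGroup EX] [NormedSpace ℂ EX] [FiniteDimensional ℂ EX]
  {E𝒳 : Type u} [NormedAddCommGroup E𝒳] [NormedSpace ℂ E𝒳] [FiniteDimensional ℂ E𝒳]
  {𝒳 : Type u} [TopologicalSpace 𝒳] [ChartedSpace E𝒳 𝒳] [IsManifold 𝓘(ℂ, E𝒳) ω 𝒳]
  [IsManifold 𝓘(ℝ, E𝒳) ∞ 𝒳] [T2Space 𝒳] [SecondCountableTopology 𝒳]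
  {EB : Type u} [NormedAddCommGroup EB] [NormedSpace ℂ EB] [FiniteDimensional ℂ EB]
  {B : Type u} [TopologicalSpace B] [ChartedSpace EB B] [IsManifold 𝓘(ℂ, EB) ω B]
  {proj : 𝒳 → B}
  (G : ContMDiffRiemannianMetric 𝓘(ℝ, E𝒳) ∞ E𝒳 (fun y : 𝒳 ↦ TangentSpace 𝓘(ℝ, E𝒳) y))
  {X : B → Type u} [∀ b, TopologicalSpace (X b)] [∀ b, ChartedSpace EX (X b)]
  [∀ b, IsManifold 𝓘(ℂ, EX) ω (X b)] [∀ b, IsManifold 𝓘(ℝ, EX) ∞ (X b)]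
  [∀ b, CompactSpace (X b)] [∀ b, T2Space (X b)]
  {ι : ∀ b, X b → 𝒳}

omit [T2Space 𝒳] [SecondCountableTopology 𝒳] [FiniteDimensional ℂ EB] [IsManifold 𝓘(ℂ, EB) ω B] in
/-- **Almost isometric, almost holomorphic transport near the CENTRE of the chart ball, for the DEPENDENT diffeomorphisms
`e z hz` themselves** (Voisin I §9.3.2, soft form; `eventually_transport_defects_le_centre` with `e : ∀ p ∈ ball, …` as produced by
clause (4) of `exists_chartBall_trivialisation`).  With `Φ (c s₀) = ι s₀`, `s₀ ∈ O`,
fibre metrics `g b = (ι b)^* G` over `c⁻¹(D)` and on `X s₀`, a `g s₀`-orthonormal frame `b x` at every point of `X s₀` and `ε > 0`: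
eventually as `z → c s₀`, `z ∈ D` (witness `hz`) and `e z hz : X s₀ → X (c⁻¹ z)` satisfies
`|⟪D(e z hz) (b x i), D(e z hz) (b x j)⟫ − δᵢⱼ| ≤ ε` and `‖J ∘ D(e z hz) − D(e z hz) ∘ J‖ ≤ ε` at every `x`.
[cite: VoisinHodgeI2002, §9.3.2 Prop. 9.20] [cite: Kodaira2005, §2.3 Thm. 2.5] -/
theorem eventually_transport_defects_le_centre_dep {O : Set B} (hι : ∀ b ∈ O, IsFibreEmbedding EX E𝒳 proj b (ι b))
    (g : ∀ b, ContMDiffRiemannianMetric 𝓘(ℝ, EX) ∞ EX (fun x : X b ↦ TangentSpace 𝓘(ℝ, EX) x))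
    (hg : ∀ b ∈ O, ∀ (x : X b) (v w : TangentSpace 𝓘(ℝ, EX) x), (g b).inner x v w =
      G.inner (ι b x) (mfderiv 𝓘(ℝ, EX) 𝓘(ℝ, E𝒳) (ι b) x v) (mfderiv 𝓘(ℝ, EX) 𝓘(ℝ, E𝒳) (ι b) x w))
    {s₀ : B} {r : ℝ} {Φ : EB → X s₀ → 𝒳}
    (hbO : ∀ p ∈ ball (extChartAt 𝓘(ℂ, EB) s₀ s₀) r, (extChartAt 𝓘(ℂ, EB) s₀).symm p ∈ O)
    (hΦs : ContMDiffOn (𝓘(ℝ, EB).prod 𝓘(ℝ, EX)) 𝓘(ℝ, E𝒳) ∞ (uncurry Φ)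
      (ball (extChartAt 𝓘(ℂ, EB) s₀ s₀) r ×ˢ univ))
    (e : ∀ p ∈ ball (extChartAt 𝓘(ℂ, EB) s₀ s₀) r, X s₀ ≃ₘ^∞⟮𝓘(ℝ, EX), 𝓘(ℝ, EX)⟯ X ((extChartAt 𝓘(ℂ, EB) s₀).symm p))
    (he : ∀ p (hp : p ∈ ball (extChartAt 𝓘(ℂ, EB) s₀ s₀) r), ∀ x,
      ι ((extChartAt 𝓘(ℂ, EB) s₀).symm p) (e p hp x) = Φ p x)
    (hs₀ : s₀ ∈ O) (hΦ0 : ∀ x, Φ (extChartAt 𝓘(ℂ, EB) s₀ s₀) x = ι s₀ x) (hr : 0 < r) {N : ℕ} [Fact (finrank ℝ EX = N)]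
    {ε : ℝ} (hε : 0 < ε) :
    letI : ∀ b', RiemannianBundle (fun x : X b' ↦ TangentSpace 𝓘(ℝ, EX) x) := fun b' ↦ ⟨(g b').toRiemannianMetric⟩
    ∀ (b : ∀ x : X s₀, OrthonormalBasis (Fin N) ℝ (TangentSpace 𝓘(ℝ, EX) x)),
    ∀ᶠ z' in 𝓝 (extChartAt 𝓘(ℂ, EB) s₀ s₀), ∃ hz' : z' ∈ ball (extChartAt 𝓘(ℂ, EB) s₀ s₀) r,
      (∀ (x : X s₀) (i j : Fin N),
        |⟪mfderiv 𝓘(ℝ, EX) 𝓘(ℝ, EX) (e z' hz') x (b x i), mfderiv 𝓘(ℝ, EX) 𝓘(ℝ, EX) (e z' hz') x (b x j)⟫_ℝ - (if i = j then 1 else 0)| ≤ ε) ∧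
      (∀ x : X s₀,
        ‖(tangentJ EX (e z' hz' x)).comp (mfderiv 𝓘(ℝ, EX) 𝓘(ℝ, EX) (e z' hz') x) -
            (mfderiv 𝓘(ℝ, EX) 𝓘(ℝ, EX) (e z' hz') x).comp (tangentJ EX x)‖ ≤ ε) := by
  letI iX : ∀ b', RiemannianBundle (fun x : X b' ↦ TangentSpace 𝓘(ℝ, EX) x) := fun b' ↦ ⟨(g b').toRiemannianMetric⟩
  intro b
  classical
  haveI : FiniteDimensional ℝ EX := FiniteDimensional.complexToReal EX
  haveI : ∀ b', IsContMDiffRiemannianBundle 𝓘(ℝ, EX) ∞ EX (fun x : X b' ↦ TangentSpace 𝓘(ℝ, EX) x) :=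
    fun b' ↦ ⟨(g b').inner, (g b').contMDiff, fun _ _ _ ↦ rfl⟩
  letI iT : RiemannianBundle (fun y : 𝒳 ↦ TangentSpace 𝓘(ℝ, E𝒳) y) := ⟨G.toRiemannianMetric⟩
  haveI : IsContMDiffRiemannianBundle 𝓘(ℝ, E𝒳) ∞ E𝒳 (fun y : 𝒳 ↦ TangentSpace 𝓘(ℝ, E𝒳) y) :=
    ⟨G.inner, G.contMDiff, fun _ _ _ ↦ rfl⟩
  have hEX : finrank ℝ EX = N := Fact.out
  have hDo : IsOpen (ball (extChartAt 𝓘(ℂ, EB) s₀ s₀) r) := isOpen_ball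
  have hz : (extChartAt 𝓘(ℂ, EB) s₀ s₀) ∈ ball (extChartAt 𝓘(ℂ, EB) s₀ s₀) r := mem_ball_self hr
  set ψ₀ : X s₀ → 𝒳 := ι s₀ with hψ₀
  have hι₀ := hι s₀ hs₀
  have hψ₀J : ∀ (x : X s₀) (v : TangentSpace 𝓘(ℝ, EX) x),
      mfderiv 𝓘(ℝ, EX) 𝓘(ℝ, E𝒳) ψ₀ x (tangentJ EX x v) = tangentJ E𝒳 (ψ₀ x) (mfderiv 𝓘(ℝ, EX) 𝓘(ℝ, E𝒳) ψ₀ x v) := by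
    intro x v
    rw [tangentJ_apply, tangentJ_apply]
    exact mfderiv_real_apply_smul (hι₀.contMDiff.mdifferentiableAt (by simp)) Complex.I v
  have hιJ : ∀ z' ∈ (ball (extChartAt 𝓘(ℂ, EB) s₀ s₀) r), ∀ (y : X ((extChartAt 𝓘(ℂ, EB) s₀).symm z')) (v : TangentSpace 𝓘(ℝ, EX) y),
      mfderiv 𝓘(ℝ, EX) 𝓘(ℝ, E𝒳) (ι ((extChartAt 𝓘(ℂ, EB) s₀).symm z')) y (tangentJ EX y v) =
        tangentJ E𝒳 (ι ((extChartAt 𝓘(ℂ, EB) s₀).symm z') y) (mfderiv 𝓘(ℝ, EX) 𝓘(ℝ, E𝒳) (ι ((extChartAt 𝓘(ℂ, EB) s₀).symm z')) y v) := by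
    intro z' hz' y v
    rw [tangentJ_apply, tangentJ_apply]
    exact mfderiv_real_apply_smul ((hι _ (hbO z' hz')).contMDiff.mdifferentiableAt (by simp)) Complex.I v
  /- ### the joint family `F (w, x) = Φ w x` on `D × X s₀` -/
  set F : EB × X s₀ → 𝒳 := fun w ↦ Φ w.1 w.2 with hF
  have hFs : ContMDiffOn (𝓘(ℝ, EB).prod 𝓘(ℝ, EX)) 𝓘(ℝ, E𝒳) ∞ F ((ball (extChartAt 𝓘(ℂ, EB) s₀ s₀) r) ×ˢ univ) := by
    exact hΦs.congr fun w _ ↦ rfl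
  have hFat : ∀ w ∈ (ball (extChartAt 𝓘(ℂ, EB) s₀ s₀) r), ∀ x : X s₀, ContMDiffAt (𝓘(ℝ, EB).prod 𝓘(ℝ, EX)) 𝓘(ℝ, E𝒳) ∞ F (w, x) :=
    fun w hw x ↦ hFs.contMDiffAt ((hDo.prod isOpen_univ).mem_nhds ⟨hw, mem_univ _⟩)
  have hF0 : ∀ x, F ((extChartAt 𝓘(ℂ, EB) s₀ s₀), x) = ψ₀ x := fun x ↦ by
    simp only [hF, hψ₀]
    exact hΦ0 x
  have hF0' : (fun x ↦ F ((extChartAt 𝓘(ℂ, EB) s₀ s₀), x)) = ψ₀ := funext hF0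
  have hinner₀ : ∀ (x : X s₀) (v w : TangentSpace 𝓘(ℝ, EX) x),
      ⟪v, w⟫_ℝ = G.inner (ψ₀ x) (mfderiv 𝓘(ℝ, EX) 𝓘(ℝ, E𝒳) ψ₀ x v) (mfderiv 𝓘(ℝ, EX) 𝓘(ℝ, E𝒳) ψ₀ x w) :=
    fun x v w ↦ hg _ hs₀ x v w
  /- ### the defect estimates, uniformly on `X (c⁻¹ z)`, for parameters near `z` (KEY of `le_finrank_hodgePQ_of_fibres`) -/
  set p₀ : (ball (extChartAt 𝓘(ℂ, EB) s₀ s₀) r) := ⟨(extChartAt 𝓘(ℂ, EB) s₀ s₀), hz⟩ with hp₀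
  have KEY : ∀ ε : ℝ, 0 < ε → ∀ᶠ p : (ball (extChartAt 𝓘(ℂ, EB) s₀ s₀) r) in 𝓝 p₀, ∀ (x : X s₀) (v v' : TangentSpace 𝓘(ℝ, EX) x),
      |G.inner (F ((p : EB), x)) (mfderiv 𝓘(ℝ, EX) 𝓘(ℝ, E𝒳) (fun x ↦ F ((p : EB), x)) x v) (mfderiv 𝓘(ℝ, EX) 𝓘(ℝ, E𝒳) (fun x ↦ F ((p : EB), x)) x v') - ⟪v, v'⟫_ℝ| ≤ ε * ‖v‖ * ‖v'‖ ∧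
      G.inner (F ((p : EB), x)) (tangentJ E𝒳 (F ((p : EB), x)) (mfderiv 𝓘(ℝ, EX) 𝓘(ℝ, E𝒳) (fun x ↦ F ((p : EB), x)) x v) - mfderiv 𝓘(ℝ, EX) 𝓘(ℝ, E𝒳) (fun x ↦ F ((p : EB), x)) x (tangentJ EX x v))
        (tangentJ E𝒳 (F ((p : EB), x)) (mfderiv 𝓘(ℝ, EX) 𝓘(ℝ, E𝒳) (fun x ↦ F ((p : EB), x)) x v) - mfderiv 𝓘(ℝ, EX) 𝓘(ℝ, E𝒳) (fun x ↦ F ((p : EB), x)) x (tangentJ EX x v)) ≤ (ε * ‖v‖) ^ 2 := by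
    intro ε hε
    set Dw : ∀ (w : EB) (x : X s₀), TangentSpace 𝓘(ℝ, EX) x →L[ℝ] TangentSpace 𝓘(ℝ, E𝒳) (F (w, x)) :=
      fun w x ↦ mfderiv 𝓘(ℝ, EX) 𝓘(ℝ, E𝒳) (fun x ↦ F (w, x)) x with hDw
    have hV : ∀ {Y : (x : X s₀) → TangentSpace 𝓘(ℝ, EX) x} {zz : EB × X s₀}, zz.1 ∈ (ball (extChartAt 𝓘(ℂ, EB) s₀ s₀) r) →
        ContMDiffAt 𝓘(ℝ, EX) 𝓘(ℝ, EX).tangent 0 (fun x ↦ (⟨x, Y x⟩ : TangentBundle 𝓘(ℝ, EX) (X s₀))) zz.2 →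
        ContMDiffAt (𝓘(ℝ, EB).prod 𝓘(ℝ, EX)) 𝓘(ℝ, E𝒳).tangent 0
          (fun zz : EB × X s₀ ↦ (⟨F zz, Dw zz.1 zz.2 (Y zz.2)⟩ : TangentBundle 𝓘(ℝ, E𝒳) 𝒳)) zz := by
      intro Y zz hzz hY
      have hf : ContMDiffAt ((𝓘(ℝ, EB).prod 𝓘(ℝ, EX)).prod 𝓘(ℝ, EX)) 𝓘(ℝ, E𝒳) ∞
          (uncurry fun (zz : EB × X s₀) (y : X s₀) ↦ F (zz.1, y)) (zz, zz.2) := by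
        have h1 := hFat zz.1 hzz zz.2
        have h2 : ContMDiffAt ((𝓘(ℝ, EB).prod 𝓘(ℝ, EX)).prod 𝓘(ℝ, EX)) (𝓘(ℝ, EB).prod 𝓘(ℝ, EX)) ∞
            (fun q : (EB × X s₀) × X s₀ ↦ ((q.1.1, q.2) : EB × X s₀)) (zz, zz.2) :=
          (contMDiffAt_fst.comp _ contMDiffAt_fst).prodMk contMDiffAt_snd
        exact h1.comp (zz, zz.2) h2
      exact contMDiffAt_mfderiv_apply_section (IP := (𝓘(ℝ, EB)).prod 𝓘(ℝ, EX))
        (fun (zz : EB × X s₀) (y : X s₀) ↦ F (zz.1, y)) (fun zz ↦ zz.2) Y hf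
        contMDiffAt_snd hY (by simp)
    have hloc : ∀ x₀ : X s₀, ∃ K ∈ 𝓝 x₀, ∀ᶠ p : (ball (extChartAt 𝓘(ℂ, EB) s₀ s₀) r) in 𝓝 p₀, ∀ x ∈ K,
        ∀ (v v' : TangentSpace 𝓘(ℝ, EX) x), |G.inner (F ((p : EB), x)) (Dw p x v) (Dw p x v') - ⟪v, v'⟫_ℝ| ≤ ε * ‖v‖ * ‖v'‖ ∧
        G.inner (F ((p : EB), x)) (tangentJ E𝒳 (F ((p : EB), x)) (Dw p x v) - Dw p x (tangentJ EX x v))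
            (tangentJ E𝒳 (F ((p : EB), x)) (Dw p x v) - Dw p x (tangentJ EX x v)) ≤ (ε * ‖v‖) ^ 2 := by
      intro x₀
      set tr := trivializationAt EX (TangentSpace 𝓘(ℝ, EX)) x₀ with htr
      set bE := Module.finBasisOfFinrankEq ℝ EX hEX with hbE
      set Y : Fin N → (x : X s₀) → TangentSpace 𝓘(ℝ, EX) x := fun j ↦ tr.localFrame bE j with hY
      have hfr := tr.isLocalFrameOn_localFrame_baseSet 𝓘(ℝ, EX) ∞ bE
      have hYs : ∀ j, ∀ x ∈ tr.baseSet, ContMDiffAt 𝓘(ℝ, EX) 𝓘(ℝ, EX).tangent 0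
          (fun x ↦ (⟨x, Y j x⟩ : TangentBundle 𝓘(ℝ, EX) (X s₀))) x :=
        fun j x hx ↦ (contMDiffAt_localFrame_of_mem (n := ∞) tr bE j hx).of_le (by simp)
      have hYJs : ∀ j, ∀ x ∈ tr.baseSet, ContMDiffAt 𝓘(ℝ, EX) 𝓘(ℝ, EX).tangent 0
          (fun x ↦ (⟨x, tangentJ EX x (Y j x)⟩ : TangentBundle 𝓘(ℝ, EX) (X s₀))) x :=
        fun j x hx ↦ ContMDiffAt.tangentJ_bundle (hYs j x hx)
      obtain ⟨K, hKc, hx₀K, hKU⟩ := exists_compact_subset tr.open_baseSet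
        (FiberBundle.mem_baseSet_trivializationAt' x₀)
      haveI : CompactSpace K := isCompact_iff_compactSpace.1 hKc
      refine ⟨K, mem_interior_iff_mem_nhds.1 hx₀K, ?_⟩
      set Γ : K → Fin N → Fin N → ℝ := fun x j l ↦ ⟪Y j x, Y l x⟫_ℝ with hΓ
      set A : ∀ (w : EB) (x : X s₀) (j : Fin N), TangentSpace 𝓘(ℝ, E𝒳) (F (w, x)) :=
        fun w x j ↦ tangentJ E𝒳 (F (w, x)) (Dw w x (Y j x)) - Dw w x (tangentJ EX x (Y j x)) with hA
      set Θ₁ : (ball (extChartAt 𝓘(ℂ, EB) s₀ s₀) r) → K → Fin N → Fin N → ℝ := fun p x j l ↦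
        G.inner (F ((p : EB), x)) (Dw p x (Y j x)) (Dw p x (Y l x)) - Γ x j l with hΘ₁
      set Θ₂ : (ball (extChartAt 𝓘(ℂ, EB) s₀ s₀) r) → K → Fin N → Fin N → ℝ := fun p x j l ↦
        G.inner (F ((p : EB), x)) (A p x j) (A p x l) with hΘ₂
      have hincl : Continuous fun qq : (ball (extChartAt 𝓘(ℂ, EB) s₀ s₀) r) × K ↦ (((qq.1 : EB), (qq.2 : X s₀)) : EB × X s₀) :=
        (continuous_subtype_val.comp continuous_fst).prodMk (continuous_subtype_val.comp continuous_snd)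
      have hcont : ∀ j l, Continuous fun qq : (ball (extChartAt 𝓘(ℂ, EB) s₀ s₀) r) × K ↦ Θ₁ qq.1 qq.2 j l := by
        intro j l
        refine continuous_iff_continuousAt.2 fun qq ↦ ?_
        have hx : (qq.2 : X s₀) ∈ tr.baseSet := hKU qq.2.2
        have hw : ((qq.1 : EB), (qq.2 : X s₀)).1 ∈ (ball (extChartAt 𝓘(ℂ, EB) s₀ s₀) r) := qq.1.2
        have h1 : ContinuousAt (fun zz : EB × X s₀ ↦
            G.inner (F zz) (Dw zz.1 zz.2 (Y j zz.2)) (Dw zz.1 zz.2 (Y l zz.2))) ((qq.1 : EB), (qq.2 : X s₀)) :=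
          continuousAt_inner_of_contMDiffAt G (hV hw (hYs j _ hx)) (hV hw (hYs l _ hx))
        have h2 : ContinuousAt (fun zz : EB × X s₀ ↦
            (g s₀).inner zz.2 (Y j zz.2) (Y l zz.2)) ((qq.1 : EB), (qq.2 : X s₀)) := by
          have := continuousAt_inner_of_contMDiffAt (IP := 𝓘(ℝ, EX)) (g s₀) (hYs j _ hx) (hYs l _ hx)
          exact ContinuousAt.comp (f := (Prod.snd : EB × X s₀ → X s₀))
            (x := ((qq.1 : EB), (qq.2 : X s₀))) this continuousAt_snd
        exact ContinuousAt.comp (f := fun qq : (ball (extChartAt 𝓘(ℂ, EB) s₀ s₀) r) × K ↦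
          (((qq.1 : EB), (qq.2 : X s₀)) : EB × X s₀)) (h1.sub h2) hincl.continuousAt
      have hcont₂ : ∀ j l, Continuous fun qq : (ball (extChartAt 𝓘(ℂ, EB) s₀ s₀) r) × K ↦ Θ₂ qq.1 qq.2 j l := by
        intro j l
        refine continuous_iff_continuousAt.2 fun qq ↦ ?_
        have hx : (qq.2 : X s₀) ∈ tr.baseSet := hKU qq.2.2
        have hw : ((qq.1 : EB), (qq.2 : X s₀)).1 ∈ (ball (extChartAt 𝓘(ℂ, EB) s₀ s₀) r) := qq.1.2
        have hAj : ∀ j, ContMDiffAt (𝓘(ℝ, EB).prod 𝓘(ℝ, EX)) 𝓘(ℝ, E𝒳).tangent 0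
            (fun zz : EB × X s₀ ↦ (⟨F zz, A zz.1 zz.2 j⟩ : TangentBundle 𝓘(ℝ, E𝒳) 𝒳))
            ((qq.1 : EB), (qq.2 : X s₀)) := by
          intro j
          have hJV := ContMDiffAt.tangentJ_bundle (hV hw (hYs j _ hx) (zz := ((qq.1 : EB), (qq.2 : X s₀))))
          have hV' := hV hw (hYJs j _ hx) (zz := ((qq.1 : EB), (qq.2 : X s₀)))
          rw [contMDiffAt_totalSpace] at hJV hV' ⊢
          refine ⟨hV'.1, ?_⟩
          have := hJV.2.sub hV'.2
          refine this.congr_of_eventuallyEq (Eventually.of_forall fun zz ↦ ?_)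
          simp only [trivializationAt_tangentSpace_snd, hA]
          exact (tangentCoordChange 𝓘(ℝ, E𝒳) _ _ _).map_sub _ _
        have h1 : ContinuousAt (fun zz : EB × X s₀ ↦
            G.inner (F zz) (A zz.1 zz.2 j) (A zz.1 zz.2 l)) ((qq.1 : EB), (qq.2 : X s₀)) :=
          continuousAt_inner_of_contMDiffAt G (hAj j) (hAj l)
        exact ContinuousAt.comp (f := fun qq : (ball (extChartAt 𝓘(ℂ, EB) s₀ s₀) r) × K ↦
          (((qq.1 : EB), (qq.2 : X s₀)) : EB × X s₀)) h1 hincl.continuousAt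
      have hDw0 : ∀ x : X s₀, Dw (extChartAt 𝓘(ℂ, EB) s₀ s₀) x = mfderiv 𝓘(ℝ, EX) 𝓘(ℝ, E𝒳) ψ₀ x := fun x ↦ by
        simp only [hDw]; rw [hF0']
      have hΘ₁0 : ∀ (x : K) j l, Θ₁ p₀ x j l = 0 := fun x j l ↦ by
        simp only [hΘ₁, hΓ, hp₀]; rw [hinner₀, metric_inner_congr_point G (hF0 x), hDw0]; exact sub_eq_zero.2 rfl
      have hDw0v : ∀ (x : X s₀) (vv : TangentSpace 𝓘(ℝ, EX) x),
          Dw (extChartAt 𝓘(ℂ, EB) s₀ s₀) x vv = mfderiv 𝓘(ℝ, EX) 𝓘(ℝ, E𝒳) ψ₀ x vv := fun x vv ↦ by rw [hDw0]; rfl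
      have hA0 : ∀ (x : X s₀) j, A (extChartAt 𝓘(ℂ, EB) s₀ s₀) x j = 0 := fun x j ↦ by
        simp only [hA]; rw [hDw0v, hDw0v, hψ₀J]; exact sub_eq_zero.2 rfl
      have hΘ₂0 : ∀ (x : K) j l, Θ₂ p₀ x j l = 0 := fun x j l ↦ by simp only [hΘ₂, hp₀]; rw [hA0, hA0, map_zero]
      have hΓc : ∀ j l, Continuous fun x : K ↦ Γ x j l := by
        intro j l
        refine continuous_iff_continuousAt.2 fun x ↦ ?_
        have := continuousAt_inner_of_contMDiffAt (IP := 𝓘(ℝ, EX)) (g s₀) (hYs j _ (hKU x.2))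
          (hYs l _ (hKU x.2))
        exact ContinuousAt.comp (f := (Subtype.val : K → X s₀)) this continuous_subtype_val.continuousAt
      have hsumΓ : ∀ (x : X s₀) (cc cc' : Fin N → ℝ), ∑ j, ∑ l, cc j * cc' l * ⟪Y j x, Y l x⟫_ℝ =
          ⟪∑ j, cc j • Y j x, ∑ l, cc' l • Y l x⟫_ℝ := by
        intro x cc cc'
        rw [← innerSL_apply_apply ℝ (∑ j, cc j • Y j x) (∑ l, cc' l • Y l x), clm_sum_smul_sum_smul]
        rfl
      have hΓpos : ∀ (x : K) (cc : Fin N → ℝ), cc ≠ 0 → 0 < ∑ j, ∑ l, cc j * cc l * Γ x j l := by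
        intro x cc hcc
        have hli : LinearIndependent ℝ (fun j ↦ Y j (x : X s₀)) := hfr.linearIndependent (hKU x.2)
        have hv : (∑ j, cc j • Y j (x : X s₀)) ≠ 0 := by
          intro h0
          exact hcc (funext fun j ↦ (Fintype.linearIndependent_iff.1 hli) cc h0 j)
        simp only [hΓ]
        rw [hsumΓ]
        exact real_inner_self_pos.2 hv
      have hU₁ := eventually_abs_sum_mul_mul_le_mul_sqrt (p₀ := p₀) Θ₁ Γ hcont hΘ₁0 hΓc hΓpos hε
      have hU₂ := eventually_abs_sum_mul_mul_le_mul_sqrt (p₀ := p₀) Θ₂ Γ hcont₂ hΘ₂0 hΓc hΓpos (pow_pos hε 2)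
      filter_upwards [hU₁, hU₂] with p h₁ h₂ x hx v v'
      have hxU : x ∈ tr.baseSet := hKU hx
      set xK : K := ⟨x, hx⟩ with hxK
      set β := hfr.toBasisAt hxU with hβ
      have hβY : ∀ j, β j = Y j x := fun j ↦ hfr.toBasisAt_coe hxU j
      set cc : Fin N → ℝ := fun j ↦ β.repr v j with hcc
      set cc' : Fin N → ℝ := fun j ↦ β.repr v' j with hcc'
      have hv : v = ∑ j, cc j • Y j x := by
        conv_lhs => rw [← β.sum_repr v]
        exact Finset.sum_congr rfl fun j _ ↦ by rw [hβY]
      have hv' : v' = ∑ j, cc' j • Y j x := by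
        conv_lhs => rw [← β.sum_repr v']
        exact Finset.sum_congr rfl fun j _ ↦ by rw [hβY]
      have hnorm : ∀ (vv : TangentSpace 𝓘(ℝ, EX) x) (dd : Fin N → ℝ), vv = ∑ j, dd j • Y j x →
          Real.sqrt (∑ j, ∑ l, dd j * dd l * Γ xK j l) = ‖vv‖ := by
        intro vv dd hvv
        simp only [hΓ]
        rw [hsumΓ, ← hvv, real_inner_self_eq_norm_sq, Real.sqrt_sq (norm_nonneg _)]
      have hnv := hnorm v cc hv
      have hnv' := hnorm v' cc' hv'
      have hDv : ∀ (vv : TangentSpace 𝓘(ℝ, EX) x) (dd : Fin N → ℝ), vv = ∑ j, dd j • Y j x →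
          Dw p x vv = ∑ j, dd j • Dw p x (Y j x) := by
        intro vv dd hvv
        rw [hvv, map_sum]
        exact Finset.sum_congr rfl fun j _ ↦ by rw [map_smul]
      refine ⟨?_, ?_⟩
      · have hexp : G.inner (F ((p : EB), x)) (Dw p x v) (Dw p x v') - ⟪v, v'⟫_ℝ =
            ∑ j, ∑ l, cc j * cc' l * Θ₁ p xK j l := by
          simp only [hΘ₁, hΓ, mul_sub, Finset.sum_sub_distrib]
          rw [hsumΓ, ← hv, ← hv', hDv v cc hv, hDv v' cc' hv', clm_sum_smul_sum_smul]
        rw [hexp]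
        refine (h₁ xK cc cc').trans (le_of_eq ?_)
        rw [hnv, hnv']
      · have hAv : tangentJ E𝒳 (F ((p : EB), x)) (Dw p x v) - Dw p x (tangentJ EX x v) =
            ∑ j, cc j • A p x j := by
          have hJv : tangentJ EX x v = ∑ j, cc j • tangentJ EX x (Y j x) := by
            rw [hv, map_sum]
            exact Finset.sum_congr rfl fun j _ ↦ by rw [map_smul]
          rw [hDv v cc hv, hJv, map_sum, map_sum, ← Finset.sum_sub_distrib]
          refine Finset.sum_congr rfl fun j _ ↦ ?_
          rw [map_smul, map_smul, hA, smul_sub]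
        rw [hAv, clm_sum_smul_sum_smul]
        calc ∑ j, ∑ l, cc j * cc l * G.inner (F ((p : EB), x)) (A p x j) (A p x l)
            ≤ |∑ j, ∑ l, cc j * cc l * Θ₂ p xK j l| := le_abs_self _
          _ ≤ ε ^ 2 * Real.sqrt (∑ j, ∑ l, cc j * cc l * Γ xK j l) *
                Real.sqrt (∑ j, ∑ l, cc j * cc l * Γ xK j l) := h₂ xK cc cc
          _ = (ε * ‖v‖) ^ 2 := by rw [hnv]; ring
    choose Kx hKx hKw using hloc
    obtain ⟨t, -, ht⟩ := isCompact_univ.elim_nhds_subcover Kx fun x _ ↦ hKx x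
    have hall : ∀ᶠ p : (ball (extChartAt 𝓘(ℂ, EB) s₀ s₀) r) in 𝓝 p₀, ∀ x₁ ∈ t, ∀ x ∈ Kx x₁,
        ∀ (v v' : TangentSpace 𝓘(ℝ, EX) x), |G.inner (F ((p : EB), x)) (Dw p x v) (Dw p x v') - ⟪v, v'⟫_ℝ| ≤ ε * ‖v‖ * ‖v'‖ ∧
        G.inner (F ((p : EB), x)) (tangentJ E𝒳 (F ((p : EB), x)) (Dw p x v) - Dw p x (tangentJ EX x v))
            (tangentJ E𝒳 (F ((p : EB), x)) (Dw p x v) - Dw p x (tangentJ EX x v)) ≤ (ε * ‖v‖) ^ 2 :=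
      (t.eventually_all.2 fun x₁ _ ↦ hKw x₁)
    filter_upwards [hall] with p hp x v v'
    obtain ⟨x₁, hx₁t, hxK⟩ := mem_iUnion₂.1 (ht (mem_univ x))
    exact hp x₁ hx₁t x hxK v v'
  /- ### from the subtype filter to `𝓝 (c s₀)`, and the conversion to the diffeomorphisms `e z'` -/
  have KEYε := KEY ε hε
  rw [hp₀, nhds_subtype_eq_comap, eventually_comap] at KEYε
  have hzD : ∀ᶠ z' in 𝓝 (extChartAt 𝓘(ℂ, EB) s₀ s₀), z' ∈ (ball (extChartAt 𝓘(ℂ, EB) s₀ s₀) r) := hDo.mem_nhds hz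
  filter_upwards [KEYε, hzD] with z' hz'KEY hz'D
  have hbd := hz'KEY ⟨z', hz'D⟩ rfl
  set Ψ := e z' hz'D with hΨ
  have hΨpt : ∀ y, ι ((extChartAt 𝓘(ℂ, EB) s₀).symm z') (Ψ y) = F (z', y) := fun y ↦ by
    simp only [hΨ, hF]
    exact he z' hz'D _
  have hDΨ : ∀ (y : X s₀) (v : TangentSpace 𝓘(ℝ, EX) y),
      mfderiv 𝓘(ℝ, EX) 𝓘(ℝ, E𝒳) (ι ((extChartAt 𝓘(ℂ, EB) s₀).symm z')) (Ψ y) (mfderiv 𝓘(ℝ, EX) 𝓘(ℝ, EX) Ψ y v) =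
        mfderiv 𝓘(ℝ, EX) 𝓘(ℝ, E𝒳) (fun y ↦ F (z', y)) y v := by
    intro y v
    have hcomp : (ι ((extChartAt 𝓘(ℂ, EB) s₀).symm z')) ∘ Ψ = fun y ↦ F (z', y) := funext hΨpt
    have hch := mfderiv_comp y (((hι _ (hbO z' hz'D)).contMDiff_real.mdifferentiableAt (by simp))) (Ψ.mdifferentiable (by simp) y)
    rw [hcomp] at hch
    rw [hch]
    rfl
  refine ⟨hz'D, ?_, ?_⟩
  · -- Gram defect on the orthonormal frame
    intro x i j
    have horth : (if i = j then (1 : ℝ) else 0) = ⟪b x i, b x j⟫_ℝ :=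
      ((orthonormal_iff_ite.1 (b x).orthonormal) i j).symm
    have hinner : ⟪mfderiv 𝓘(ℝ, EX) 𝓘(ℝ, EX) Ψ x (b x i), mfderiv 𝓘(ℝ, EX) 𝓘(ℝ, EX) Ψ x (b x j)⟫_ℝ =
        G.inner (F (z', x)) (mfderiv 𝓘(ℝ, EX) 𝓘(ℝ, E𝒳) (fun y ↦ F (z', y)) x (b x i))
          (mfderiv 𝓘(ℝ, EX) 𝓘(ℝ, E𝒳) (fun y ↦ F (z', y)) x (b x j)) := by
      change (g ((extChartAt 𝓘(ℂ, EB) s₀).symm z')).inner (Ψ x) _ _ = _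
      rw [hg _ (hbO z' hz'D), metric_inner_congr_point G (hΨpt x), hDΨ, hDΨ]
    rw [horth, hinner]
    have key := (hbd x (b x i) (b x j)).1
    rwa [(b x).orthonormal.1 i, (b x).orthonormal.1 j, mul_one, mul_one] at key
  · -- holomorphy defect
    intro x
    refine ContinuousLinearMap.opNorm_le_bound _ hε.le fun v ↦ ?_
    set a := ((tangentJ EX (Ψ x)).comp (mfderiv 𝓘(ℝ, EX) 𝓘(ℝ, EX) Ψ x) -
      (mfderiv 𝓘(ℝ, EX) 𝓘(ℝ, EX) Ψ x).comp (tangentJ EX x)) v with ha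
    have hDιa : mfderiv 𝓘(ℝ, EX) 𝓘(ℝ, E𝒳) (ι ((extChartAt 𝓘(ℂ, EB) s₀).symm z')) (Ψ x) a =
        tangentJ E𝒳 (F (z', x)) (mfderiv 𝓘(ℝ, EX) 𝓘(ℝ, E𝒳) (fun y ↦ F (z', y)) x v) -
          mfderiv 𝓘(ℝ, EX) 𝓘(ℝ, E𝒳) (fun y ↦ F (z', y)) x (tangentJ EX x v) := by
      rw [ha]
      change mfderiv 𝓘(ℝ, EX) 𝓘(ℝ, E𝒳) (ι ((extChartAt 𝓘(ℂ, EB) s₀).symm z')) (Ψ x)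
        (tangentJ EX (Ψ x) (mfderiv 𝓘(ℝ, EX) 𝓘(ℝ, EX) Ψ x v) - mfderiv 𝓘(ℝ, EX) 𝓘(ℝ, EX) Ψ x (tangentJ EX x v)) = _
      rw [map_sub, hιJ z' hz'D, hDΨ, hDΨ, hΨpt]
    have hsq : ‖a‖ ^ 2 ≤ (ε * ‖v‖) ^ 2 := by
      have key := (hbd x v v).2
      calc ‖a‖ ^ 2 = ⟪a, a⟫_ℝ := (real_inner_self_eq_norm_sq a).symm
        _ = (g ((extChartAt 𝓘(ℂ, EB) s₀).symm z')).inner (Ψ x) a a := rfl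
        _ = G.inner (F (z', x)) (mfderiv 𝓘(ℝ, EX) 𝓘(ℝ, E𝒳) (ι ((extChartAt 𝓘(ℂ, EB) s₀).symm z')) (Ψ x) a)
              (mfderiv 𝓘(ℝ, EX) 𝓘(ℝ, E𝒳) (ι ((extChartAt 𝓘(ℂ, EB) s₀).symm z')) (Ψ x) a) := by
            rw [hg _ (hbO z' hz'D), metric_inner_congr_point G (hΨpt x)]
        _ ≤ (ε * ‖v‖) ^ 2 := by rw [hDιa]; exact key
    exact (pow_le_pow_iff_left₀ (norm_nonneg _) (by positivity) two_ne_zero).1 hsq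

end ChartBall

end Literature.Geometry.Kaehler

end
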